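import Mathlib
import Literature.NumberTheory.LFunctions.Zhang2022.Section11E2MeanSquare
import Literature.NumberTheory.LFunctions.Zhang2022.Section11Deductions
import Literature.NumberTheory.LFunctions.Zhang2022.Section7SjPolylog
import Literature.NumberTheory.LFunctions.Zhang2022.Section4Prop22Eventually
import Literature.NumberTheory.LFunctions.Zhang2022.Section7Prop71Holds
import HarnessLib

/-!
# Zhang (2022) §§7–8: the weighted discrete mean square `ΣΣ𝔠*(ρ,ψ)|A(𝐛;ρ,ψ)|²ω(ρ)` of an
# arbitrary admissible Dirichlet polynomial — generic reductions to Lemma 8.1 + Proposition 7.1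

Topic `Literature/NumberTheory/LFunctions/Zhang2022` (Landau–Siegel audit tree; verdict-neutral).
Y. Zhang, *Discrete mean estimates and the Landau–Siegel zero*, arXiv:2211.02515v1 (2022)
[Zhang2022LandauSiegel], §7 Prop. 7.1 (p. 33), §8 Lemma 8.1 (p. 42) — **an unrefereed manuscript
under adjudication; nothing here asserts or denies its Theorems 1–2.** The manuscript repeatedly
bounds discrete mean squares over the zeros, `Σ_{ψ∈Ψ₁}Σ_{ρ∈𝔷(ψ)} 𝔠*(ρ,ψ)|Σ_n b(n)ψ(n)n^{−ρ}|²ω(ρ)`,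
"by (8.25), (8.26)" (§11 p. 64 tex L3298, p. 65 L3352; §12 p. 67 L3415 — displays that do not exist
in v1) or "in a way similar to the proof of Proposition 2.6" (§12 p. 67 L3440); the cell
`siegel-zhang` reads these as Lemma 8.1 + Proposition 7.1 at the admissible pair `(𝐛, 𝐛̄)`. The tree
carries that reading SEQUENCE BY SEQUENCE (`Section11E2MeanSquare.dmv_of_lemma81_prop71` for
`χ(n)n^{−iv}1_{n<P₁}`, `Section11Deductions.totalMass_le` for `δ₁`, `Typed.Sec12A.eq126_of_sj_small`
for the (12.6)-sequence). THIS FILE states it ONCE for an ARBITRARY admissible sequence `𝐛`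
(ZHANG-L lane, LIB-B «discrete mean values»; consumers: the (12.8)-reduction, the §11 window mean
squares `Step11u019/J2`, (12.6)):

* `re_lhs81_self_conj` — at a modulus where the zeros lie on `σ = ½` (Prop. 2.2 (i)) and `𝔠*(ρ,ψ)`,
  `ω(ρ)` are real (Lemma 2.3), the left side of Lemma 8.1 at `(𝐛, 𝐛̄)` has real part
  `ΣΣ Re 𝔠*(ρ,ψ)·|A(𝐛;ρ,ψ)|²·Re ω(ρ)` (`Section11E2MeanSquare.lhs81_conj_eq`);
* `meanSq_le_two_norm_Theta1_add` — hence, by Lemma 8.1 (error `ε𝔓`),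
  `ΣΣ Re 𝔠*|A(𝐛;ρ)|² Re ω ≤ 2|Θ₁(𝐛,𝐛̄)| + ε𝔓`;
* `norm_Theta1_le_of_sj_le` — and by Proposition 7.1 (constant `C`, error `ε𝔓`), if
  `|S_j(𝐛,𝐛̄)| ≤ σ` (`j = 1,2,3`) then `|Θ₁(𝐛,𝐛̄)| ≤ (4α⁻¹ + 3|C|𝓛²)σ𝔓 + ε𝔓`;
* `meanSq_le_polylog` — **the crude discrete mean value, uniform over all sequences admissible for
  (7.2) with `|b(n)| ≤ 1`**: `ΣΣ Re 𝔠*|A(𝐛;ρ)|² Re ω ≤ K𝓛⁸¹𝔓` for all large `D` under (A)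
  (`XiZeroMajorant.sjPolylog`: `|S_j| ≤ K₀𝓛⁷²`; `α⁻¹ = 𝓛⁹/π`);
* `meanSq_le_of_sj_small` — **the fine reduction**: for a sequence `𝐛_{D,χ}` admissible with a fixed
  bound `B`, the unprinted estimate «`S_j(𝐛,𝐛̄) = o(α𝔞)`» (hypothesis `hS`, the shape of the cell's
  G-d42-2/G-d42-3 closers) gives `ΣΣ Re 𝔠*|A(𝐛;ρ)|² Re ω = o(𝔞𝔓)` (the proof of
  `Typed.Sec12A.eq126_of_sj_small` with the sequence abstracted; `𝔞 ≫ 1` by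
  `Skeleton.frakALowerBound_holds`);
* `meanSq_le_polylog_eventually`, `meanSq_le_of_sj_small_eventually` — closed forms for every
  sufficiently large `c′` (Prop. 2.2 (i) `Skeleton.prop22i_holds`, Lemma 2.3 / Lemma 8.1
  `Skeleton.partOne_eventually`, Prop. 7.1 `Section7cStatements.prop71X_holds`).

Theorems only: 0 new definitions, 0 new facts, standard axioms.

## References

* Y. Zhang, arXiv:2211.02515v1 (2022), §7 Prop. 7.1, (7.2); §8 Lemma 8.1; §11 p. 65; §12 p. 67.
  [cite: Zhang2022LandauSiegel, §7 Prop. 7.1; §8 Lemma 8.1]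
-/

noncomputable section

open Complex Real ComplexConjugate

namespace Literature.NumberTheory.LFunctions.Zhang2022.DiscreteMeanSquare

open Literature.NumberTheory.LFunctions.Zhang2022.Skeleton
open Literature.NumberTheory.LFunctions.Zhang2022.Section11E2MeanSquare
open Literature.NumberTheory.LFunctions.Zhang2022.Section11Deductions (mem_idx)

/-! ### Elementary lemmas -/

/-- For `D ≥ ⌈e^M⌉`, `𝓛 = log D ≥ M`. [cite: Zhang2022LandauSiegel, §2 p.4] -/
private theorem le_ell_of_ceil_exp_le {M : ℝ} {D : ℕ} (hD : ⌈Real.exp M⌉₊ ≤ D) : M ≤ ell D := by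
  have h : Real.exp M ≤ D := le_trans (Nat.le_ceil _) (by exact_mod_cast hD)
  exact (Real.le_log_iff_exp_le (lt_of_lt_of_le (Real.exp_pos _) h)).mpr h

/-- For `D ≥ ⌈e²⌉`, `D ≥ 3`. [folklore] -/
private theorem three_le_of_ceil_exp_two_le {D : ℕ} (hD : ⌈Real.exp 2⌉₊ ≤ D) : 3 ≤ D := by
  have h3 : (3 : ℝ) ≤ Real.exp 2 := by have := Real.add_one_le_exp (2 : ℝ); linarith
  have : (3 : ℝ) ≤ (D : ℝ) := le_trans (le_trans h3 (Nat.le_ceil _)) (by exact_mod_cast hD)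
  exact_mod_cast this

section Pointwise

variable (c' : ℝ) {D : ℕ} (χ : DirichletCharacter ℂ D)

/-- **`Re lhs81(𝐛,𝐛̄) = ΣΣ Re 𝔠*(ρ,ψ)·|A(𝐛;ρ,ψ)|²·Re ω(ρ)`** when the zeros lie on `σ = ½` and the
weights are real (`A(𝐛̄;1−ρ,ψ̄) = conj A(𝐛;ρ,ψ)`, `Section11E2MeanSquare.lhs81_conj_eq`).
[cite: Zhang2022LandauSiegel, §8 Lemma 8.1; §2 Lemma 2.3, Prop. 2.2 (i)] -/
theorem re_lhs81_self_conj (b : ℕ → ℂ) (hre : ∀ i ∈ idx χ, i.2.re = 1 / 2)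
    (hcIm : ∀ i ∈ idx χ, (cstar c' D i.1 i.2).im = 0)
    (hωIm : ∀ i ∈ idx χ, (omegaW D i.2).im = 0) :
    (lhs81 c' χ b (fun n => conj (b n))).re =
      ∑ i ∈ idx χ, (cstar c' D i.1 i.2).re * ‖Apoly i.1 b i.2‖ ^ 2 * (omegaW D i.2).re := by
  rw [lhs81_conj_eq c' χ b hre, Complex.re_sum]
  refine Finset.sum_congr rfl fun i hi => ?_
  rw [Complex.mul_re, Complex.mul_re, Complex.mul_im, hcIm i hi, hωIm i hi, Complex.ofReal_re,
    Complex.ofReal_im]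
  ring

/-- **Lemma 8.1 as an inequality for the mean square**: if at `(𝐛,𝐛̄)` the left side of Lemma 8.1
is within `E` of `Θ₁(𝐛,𝐛̄) + conj Θ₁(𝐛,𝐛̄)`, then `ΣΣ Re 𝔠*|A(𝐛;ρ)|² Re ω ≤ 2|Θ₁(𝐛,𝐛̄)| + E`.
[cite: Zhang2022LandauSiegel, §8 Lemma 8.1] -/
theorem meanSq_le_two_norm_Theta1_add (b : ℕ → ℂ) (hre : ∀ i ∈ idx χ, i.2.re = 1 / 2)
    (hcIm : ∀ i ∈ idx χ, (cstar c' D i.1 i.2).im = 0)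
    (hωIm : ∀ i ∈ idx χ, (omegaW D i.2).im = 0) {E : ℝ}
    (h81 : ‖lhs81 c' χ b (fun n => conj (b n)) -
        (Theta1 c' χ b (fun n => conj (b n)) +
          conj (Theta1 c' χ (fun n => conj (conj (b n))) (fun n => conj (b n))))‖ ≤ E) :
    ∑ i ∈ idx χ, (cstar c' D i.1 i.2).re * ‖Apoly i.1 b i.2‖ ^ 2 * (omegaW D i.2).re ≤
      2 * ‖Theta1 c' χ b (fun n => conj (b n))‖ + E := by
  have hbb : (fun n => conj (conj (b n))) = b := by funext n; simp
  rw [hbb] at h81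
  set T := Theta1 c' χ b (fun n => conj (b n)) with hT
  set L := lhs81 c' χ b (fun n => conj (b n)) with hL
  calc ∑ i ∈ idx χ, (cstar c' D i.1 i.2).re * ‖Apoly i.1 b i.2‖ ^ 2 * (omegaW D i.2).re
      = L.re := (re_lhs81_self_conj c' χ b hre hcIm hωIm).symm
    _ ≤ ‖L‖ := Complex.re_le_norm _
    _ ≤ ‖T + conj T‖ + ‖L - (T + conj T)‖ := norm_le_insert' _ _
    _ ≤ (‖T‖ + ‖T‖) + E := by
        refine add_le_add (le_trans (norm_add_le _ _) ?_) h81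
        rw [RCLike.norm_conj]
    _ = 2 * ‖T‖ + E := by ring

/-- **Proposition 7.1 as an inequality for `|Θ₁|`**: if `|Θ₁(𝐛₁,𝐛₂) − main| ≤ C·E(𝐛₁,𝐛₂) + E₀` and
`|S_j(𝐛₁,𝐛₂)| ≤ σ` (`j = 1,2,3`), then `|Θ₁(𝐛₁,𝐛₂)| ≤ (4α⁻¹ + 3|C|𝓛²)σ𝔓 + E₀`
(main term `α⁻¹(½S₁+2S₂+3/2S₃)𝔓`, `E = 𝔓𝓛²Σ|S_j|`). [cite: Zhang2022LandauSiegel, §7 Prop. 7.1] -/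
theorem norm_Theta1_le_of_sj_le {Θ : ℂ} {b₁ b₂ : ℕ → ℂ} {C E₀ σ : ℝ}
    (h71 : ‖Θ - mainMV c' D b₁ b₂‖ ≤ C * Ecal c' D b₁ b₂ + E₀)
    (hS1 : ‖Sj c' D 1 b₁ b₂‖ ≤ σ) (hS2 : ‖Sj c' D 2 b₁ b₂‖ ≤ σ) (hS3 : ‖Sj c' D 3 b₁ b₂‖ ≤ σ)
    (hα : 0 < alpha D) :
    ‖Θ‖ ≤ (4 * (alpha D)⁻¹ + 3 * |C| * ell D ^ 2) * σ * frakP D + E₀ := by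
  have hP : 0 ≤ frakP D := frakP_nonneg D
  have hσ : 0 ≤ σ := le_trans (norm_nonneg _) hS1
  have hE : Ecal c' D b₁ b₂ ≤ 3 * ell D ^ 2 * σ * frakP D := by
    rw [Ecal]
    calc frakP D * ell D ^ 2 * (‖Sj c' D 1 b₁ b₂‖ + ‖Sj c' D 2 b₁ b₂‖ + ‖Sj c' D 3 b₁ b₂‖)
        ≤ frakP D * ell D ^ 2 * (σ + σ + σ) := by gcongr
      _ = 3 * ell D ^ 2 * σ * frakP D := by ring
  have hmain : ‖mainMV c' D b₁ b₂‖ ≤ 4 * (alpha D)⁻¹ * σ * frakP D := by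
    rw [mainMV, norm_mul, norm_mul, Complex.norm_real, Real.norm_of_nonneg hP, norm_inv,
      Complex.norm_real, Real.norm_of_nonneg hα.le]
    have hsum : ‖1 / 2 * Sj c' D 1 b₁ b₂ + 2 * Sj c' D 2 b₁ b₂ + 3 / 2 * Sj c' D 3 b₁ b₂‖ ≤ 4 * σ := by
      calc _ ≤ ‖1 / 2 * Sj c' D 1 b₁ b₂‖ + ‖2 * Sj c' D 2 b₁ b₂‖ + ‖3 / 2 * Sj c' D 3 b₁ b₂‖ :=
            norm_add₃_le
        _ = 1 / 2 * ‖Sj c' D 1 b₁ b₂‖ + 2 * ‖Sj c' D 2 b₁ b₂‖ + 3 / 2 * ‖Sj c' D 3 b₁ b₂‖ := by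
            rw [norm_mul, norm_mul, norm_mul]; norm_num
        _ ≤ 1 / 2 * σ + 2 * σ + 3 / 2 * σ := by gcongr
        _ = 4 * σ := by ring
    calc (alpha D)⁻¹ * ‖1 / 2 * Sj c' D 1 b₁ b₂ + 2 * Sj c' D 2 b₁ b₂ + 3 / 2 * Sj c' D 3 b₁ b₂‖ *
          frakP D ≤ (alpha D)⁻¹ * (4 * σ) * frakP D := by gcongr
      _ = 4 * (alpha D)⁻¹ * σ * frakP D := by ring
  have hE0 : 0 ≤ Ecal c' D b₁ b₂ := by rw [Ecal]; positivity
  have h2 : C * Ecal c' D b₁ b₂ ≤ |C| * (3 * ell D ^ 2 * σ * frakP D) :=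
    le_trans (mul_le_mul_of_nonneg_right (le_abs_self C) hE0)
      (mul_le_mul_of_nonneg_left hE (abs_nonneg C))
  calc ‖Θ‖ ≤ ‖mainMV c' D b₁ b₂‖ + ‖Θ - mainMV c' D b₁ b₂‖ := norm_le_insert' _ _
    _ ≤ 4 * (alpha D)⁻¹ * σ * frakP D + (|C| * (3 * ell D ^ 2 * σ * frakP D) + E₀) := by
        linarith
    _ = (4 * (alpha D)⁻¹ + 3 * |C| * ell D ^ 2) * σ * frakP D + E₀ := by ring

end Pointwise

/-! ### The crude bound, uniform over `(7.2)`-admissible sequences with `|b| ≤ 1` -/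

section Crude

variable (c' : ℝ)

/-- **Crude discrete mean value**: Lemma 2.3, Prop. 2.2 (i), Lemma 8.1, Prop. 7.1 give an
absolute `K` with `ΣΣ Re 𝔠*(ρ,ψ)|A(𝐛;ρ,ψ)|² Re ω(ρ) ≤ K𝓛⁸¹𝔓` for ALL sequences `𝐛` admissible
for (7.2) with `|b(n)| ≤ 1`, all large `D`, under (A) — via `|S_j(𝐛,𝐛̄)| ≤ K₀𝓛⁷²`
(`XiZeroMajorant.sjPolylog`) and `α⁻¹ = 𝓛⁹/π`. The uniform form of
`Section11E2MeanSquare.dmv_of_lemma81_prop71`. [cite: Zhang2022LandauSiegel, §11 p.65; §7 Prop. 7.1; §8 Lemma 8.1] -/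
theorem meanSq_le_polylog (h23 : Lemma23 c') (h22 : Prop22i) (h81 : Lemma81 c')
    (h71 : Prop71 c') :
    ∃ K : ℝ, 0 < K ∧ ForAllLarge fun D _ χ => AssumptionA D χ → ∀ b : ℕ → ℂ, Adm72 D 1 b →
      ∑ i ∈ idx χ, (cstar c' D i.1 i.2).re * ‖Apoly i.1 b i.2‖ ^ 2 * (omegaW D i.2).re ≤
        K * ell D ^ 81 * frakP D := by
  obtain ⟨K₀, hS⟩ := XiZeroMajorant.sjPolylog c'
  obtain ⟨C, D₁, h71'⟩ := h71 1 1 one_pos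
  obtain ⟨D₀, h⟩ := ((h22.and h23).and hS).and (h81 1 1 one_pos)
  refine ⟨2 * ((4 / π + 3 * |C|) * |K₀| + 1) + 1, by positivity, max (max D₀ D₁) ⌈Real.exp 2⌉₊,
    fun D _ χ hD hq hp hA b hb => ?_⟩
  have hD₀ : D₀ ≤ D := le_trans (le_trans (le_max_left _ _) (le_max_left _ _)) hD
  have hD₁ : D₁ ≤ D := le_trans (le_trans (le_max_right _ _) (le_max_left _ _)) hD
  have hℓ : 2 ≤ ell D := le_ell_of_ceil_exp_le (le_trans (le_max_right _ _) hD)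
  have hD3 : 3 ≤ D := three_le_of_ceil_exp_two_le (le_trans (le_max_right _ _) hD)
  have hℓ0 : 0 < ell D := by linarith
  obtain ⟨⟨⟨h22', h23'⟩, hS'⟩, h81'⟩ := h D χ hD₀ hq hp
  have h71D := h71' D χ hD₁ hq hp hA
  -- the conjugate sequence
  set bb : ℕ → ℂ := fun n => conj (b n) with hbb
  have hbdm : Adm72 D 1 bb := adm72_conj hb
  -- pointwise facts at the zeros
  have mem : ∀ i ∈ idx χ, i.1 ∈ PsiOne χ ∧ i.2 ∈ zeroSet D i.1 := fun i hi => mem_idx χ hi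
  have hre : ∀ i ∈ idx χ, i.2.re = 1 / 2 := fun i hi =>
    h22' i.1 (mem i hi).1 i.2 (mem_prodZeroSetOmega_of_mem_zeroSet χ (mem i hi).2)
  have hcIm : ∀ i ∈ idx χ, (cstar c' D i.1 i.2).im = 0 := fun i hi =>
    (h23' i.1 (mem i hi).1 i.2 (mem i hi).2).1
  have hωIm : ∀ i ∈ idx χ, (omegaW D i.2).im = 0 := fun i hi => (omegaW_re_pos hD3 (hre i hi)).2
  -- Lemma 8.1 and Prop 7.1 at (b, bb)
  have k81 := h81' hA b bb hb hbdm
  have k71 := h71D b bb hb hbdm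
  have hS1 := hS' 1 (by simp) b bb hb hbdm
  have hS2 := hS' 2 (by simp) b bb hb hbdm
  have hS3 := hS' 3 (by simp) b bb hb hbdm
  have hP : 0 ≤ frakP D := frakP_nonneg D
  have hα : alpha D = π / ell D ^ 9 := by rw [alpha, bigP, Real.log_exp]
  have hα0 : 0 < alpha D := by rw [hα]; positivity
  have hK : K₀ * ell D ^ 72 ≤ |K₀| * ell D ^ 72 :=
    mul_le_mul_of_nonneg_right (le_abs_self K₀) (by positivity)
  have hΘ := norm_Theta1_le_of_sj_le c' (D := D) k71 (hS1.trans hK) (hS2.trans hK) (hS3.trans hK)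
    hα0
  have hms := meanSq_le_two_norm_Theta1_add c' χ b hre hcIm hωIm k81
  -- sizes
  have hinv : (alpha D)⁻¹ = ell D ^ 9 / π := by rw [hα, inv_div]
  have h72 : (4 * (alpha D)⁻¹ + 3 * |C| * ell D ^ 2) * (|K₀| * ell D ^ 72) * frakP D ≤
      (4 / π + 3 * |C|) * |K₀| * ell D ^ 81 * frakP D := by
    rw [hinv]
    have h29 : ell D ^ 2 ≤ ell D ^ 9 := pow_le_pow_right₀ (by linarith) (by norm_num)
    have hstep : 4 * (ell D ^ 9 / π) + 3 * |C| * ell D ^ 2 ≤ (4 / π + 3 * |C|) * ell D ^ 9 := by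
      have : 3 * |C| * ell D ^ 2 ≤ 3 * |C| * ell D ^ 9 := by gcongr
      have e : 4 * (ell D ^ 9 / π) = 4 / π * ell D ^ 9 := by ring
      linarith
    calc (4 * (ell D ^ 9 / π) + 3 * |C| * ell D ^ 2) * (|K₀| * ell D ^ 72) * frakP D
        ≤ ((4 / π + 3 * |C|) * ell D ^ 9) * (|K₀| * ell D ^ 72) * frakP D := by gcongr
      _ = (4 / π + 3 * |C|) * |K₀| * ell D ^ 81 * frakP D := by ring
  have h81' : 1 ≤ ell D ^ 81 := one_le_pow₀ (by linarith)
  calc ∑ i ∈ idx χ, (cstar c' D i.1 i.2).re * ‖Apoly i.1 b i.2‖ ^ 2 * (omegaW D i.2).re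
      ≤ 2 * ‖Theta1 c' χ b bb‖ + 1 * frakP D := hms
    _ ≤ 2 * ((4 * (alpha D)⁻¹ + 3 * |C| * ell D ^ 2) * (|K₀| * ell D ^ 72) * frakP D +
          1 * frakP D) + 1 * frakP D := by gcongr
    _ ≤ 2 * ((4 / π + 3 * |C|) * |K₀| * ell D ^ 81 * frakP D + 1 * frakP D) + 1 * frakP D := by
        gcongr
    _ ≤ (2 * ((4 / π + 3 * |C|) * |K₀| + 1) + 1) * ell D ^ 81 * frakP D := by
        nlinarith [mul_le_mul_of_nonneg_right h81' hP]

/-- **Crude discrete mean value, closed form**: for every sufficiently large `c′`, an absolute `K`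
with `ΣΣ Re 𝔠*|A(𝐛;ρ)|² Re ω ≤ K𝓛⁸¹𝔓` for all `(7.2)`-admissible `|b| ≤ 1`, large `D`, under (A)
— no hypothesis (Lemma 2.3 and Lemma 8.1: `Skeleton.partOne_eventually`; Prop. 2.2 (i):
`Skeleton.prop22i_holds`; Prop. 7.1: `Section7cStatements.prop71X_holds`).
[cite: Zhang2022LandauSiegel, §7 Prop. 7.1; §8 Lemma 8.1] -/
theorem meanSq_le_polylog_eventually :
    ∃ c₀ : ℝ, 0 ≤ c₀ ∧ ∀ c' : ℝ, c₀ ≤ c' →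
      ∃ K : ℝ, 0 < K ∧ ForAllLarge fun D _ χ => AssumptionA D χ → ∀ b : ℕ → ℂ, Adm72 D 1 b →
        ∑ i ∈ idx χ, (cstar c' D i.1 i.2).re * ‖Apoly i.1 b i.2‖ ^ 2 * (omegaW D i.2).re ≤
          K * ell D ^ 81 * frakP D := by
  obtain ⟨c₀, h0, h⟩ := partOne_eventually
  exact ⟨c₀, h0, fun c' hc' =>
    meanSq_le_polylog c' (h c' hc').2.1 prop22i_holds (h c' hc').2.2.1
      (Section7cStatements.prop71X_holds c')⟩

end Crude

/-! ### The fine reduction: `S_j(𝐛,𝐛̄) = o(α𝔞)` gives `ΣΣ𝔠*|A(𝐛;ρ)|²ω = o(𝔞𝔓)` -/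

section Fine

variable (c' : ℝ)

/-- **The fine reduction** (generic form of `Typed.Sec12A.eq126_of_sj_small`): let `𝐛_{D,χ}` be a
sequence admissible for (7.2) with a fixed bound `B` (all large `D`). If, under (A),
`|S_j(𝐛,𝐛̄)| ≤ ε·α·𝔞` eventually for every `ε > 0` (`j = 1,2,3`) — the unprinted `S_j`-estimate
behind the manuscript's "(8.25), (8.26)" / "in a way similar to the proof of Proposition 2.6" —
then `ΣΣ Re 𝔠*(ρ,ψ)|A(𝐛;ρ,ψ)|² Re ω(ρ) ≤ ε𝔞𝔓` eventually for every `ε > 0` (Lemma 2.3, Prop. 2.2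
(i), Lemma 8.1, Prop. 7.1; `𝔞 ≫ 1` is the tree's `frakALowerBound_holds`).
[cite: Zhang2022LandauSiegel, §11 p.65; §12 p.67; §7 Prop. 7.1; §8 Lemma 8.1] -/
theorem meanSq_le_of_sj_small (h22 : Prop22i) (h23 : Lemma23 c') (h81 : Lemma81 c')
    (h71 : Prop71 c') {B : ℝ} (b : (D : ℕ) → DirichletCharacter ℂ D → ℕ → ℂ)
    (hadm : ForAllLarge fun D _ χ => Adm72 D B (b D χ))
    (hS : ∀ ε : ℝ, 0 < ε → ForAllLarge fun D _ χ => AssumptionA D χ →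
      ∀ j ∈ ({1, 2, 3} : Finset ℕ),
        ‖Sj c' D j (b D χ) (fun n => conj (b D χ n))‖ ≤ ε * alpha D * frakA χ) :
    ∀ ε : ℝ, 0 < ε → ForAllLarge fun D _ χ => AssumptionA D χ →
      ∑ i ∈ idx χ, (cstar c' D i.1 i.2).re * ‖Apoly i.1 (b D χ) i.2‖ ^ 2 * (omegaW D i.2).re ≤
        ε * frakA χ * frakP D := by
  intro ε hε
  obtain ⟨a₀, ha₀, hA⟩ := frakALowerBound_holds
  -- the three error budgets
  obtain ⟨C, D₁, h71'⟩ := h71 B (ε * a₀ / 8) (by positivity)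
  have hε₃ : 0 < ε / (8 * (4 + 10 * |C| + 1)) := by positivity
  obtain ⟨D₀, h⟩ := (((((h22.and h23).and hA).and (h81 B (ε * a₀ / 8) (by positivity))).and
    (hS _ hε₃)).and hadm)
  refine ⟨max (max D₀ D₁) ⌈Real.exp 2⌉₊, fun D _ χ hD hq hp hAss => ?_⟩
  have hD₀ : D₀ ≤ D := le_trans (le_trans (le_max_left _ _) (le_max_left _ _)) hD
  have hD₁ : D₁ ≤ D := le_trans (le_trans (le_max_right _ _) (le_max_left _ _)) hD
  have hL : 2 ≤ ell D := le_ell_of_ceil_exp_le (le_trans (le_max_right _ _) hD)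
  have hℓ0 : 0 < ell D := by linarith
  have hD3 : 3 ≤ D := three_le_of_ceil_exp_two_le (le_trans (le_max_right _ _) hD)
  obtain ⟨⟨⟨⟨⟨h22', h23'⟩, hA'⟩, h81'⟩, hS'⟩, hadm'⟩ := h D χ hD₀ hq hp
  have h71D := h71' D χ hD₁ hq hp hAss
  have ha : a₀ ≤ frakA χ := hA' hAss
  -- the sequence and its conjugate
  set bD : ℕ → ℂ := b D χ with hbD
  set bb : ℕ → ℂ := fun n => conj (bD n) with hbb
  have hbdm : Adm72 D B bb := adm72_conj hadm'
  have hSj := hS' hAss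
  -- pointwise facts at the zeros
  have mem : ∀ i ∈ idx χ, i.1 ∈ PsiOne χ ∧ i.2 ∈ zeroSet D i.1 := fun i hi => mem_idx χ hi
  have hre : ∀ i ∈ idx χ, i.2.re = 1 / 2 := fun i hi =>
    h22' i.1 (mem i hi).1 i.2 (mem_prodZeroSetOmega_of_mem_zeroSet χ (mem i hi).2)
  have hcIm : ∀ i ∈ idx χ, (cstar c' D i.1 i.2).im = 0 := fun i hi =>
    (h23' i.1 (mem i hi).1 i.2 (mem i hi).2).1
  have hωIm : ∀ i ∈ idx χ, (omegaW D i.2).im = 0 := fun i hi => (omegaW_re_pos hD3 (hre i hi)).2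
  -- Lemma 8.1 and Prop. 7.1 at `(b, bb)`
  have k81 := h81' hAss bD bb hadm' hbdm
  have k71 := h71D bD bb hadm' hbdm
  have hS1 := hSj 1 (by simp)
  have hS2 := hSj 2 (by simp)
  have hS3 := hSj 3 (by simp)
  have hP : 0 ≤ frakP D := frakP_nonneg D
  have hfa : 0 ≤ frakA χ := le_trans ha₀.le ha
  have hα : alpha D = π / ell D ^ 9 := by rw [alpha, bigP, Real.log_exp]
  have hα0 : 0 < alpha D := by rw [hα]; positivity
  set e3 : ℝ := ε / (8 * (4 + 10 * |C| + 1)) with he3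
  have hΘ' := norm_Theta1_le_of_sj_le c' (D := D) k71 hS1 hS2 hS3 hα0
  -- `(4α⁻¹ + 3|C|𝓛²)·(e3·α·𝔞) ≤ (4 + 10|C|)·e3·𝔞`
  have hΘ : ‖Theta1 c' χ bD bb‖ ≤ (4 + 10 * |C|) * e3 * frakA χ * frakP D + ε * a₀ / 8 * frakP D := by
    have hαL : alpha D * ell D ^ 2 ≤ π := by
      rw [hα, div_mul_eq_mul_div, div_le_iff₀ (by positivity)]
      have : ell D ^ 2 ≤ ell D ^ 9 := pow_le_pow_right₀ (by linarith) (by norm_num)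
      nlinarith [Real.pi_pos]
    have hq : 0 ≤ e3 * frakA χ * frakP D := mul_nonneg (mul_nonneg hε₃.le hfa) hP
    have hkey : (4 * (alpha D)⁻¹ + 3 * |C| * ell D ^ 2) * (e3 * alpha D * frakA χ) * frakP D ≤
        (4 + 10 * |C|) * e3 * frakA χ * frakP D := by
      have e1 : (4 * (alpha D)⁻¹ + 3 * |C| * ell D ^ 2) * (e3 * alpha D * frakA χ) * frakP D =
          (4 + 3 * |C| * (alpha D * ell D ^ 2)) * (e3 * frakA χ * frakP D) := by
        field_simp
      rw [e1]
      have hπ : 3 * |C| * (alpha D * ell D ^ 2) ≤ 10 * |C| := by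
        have h1 : 3 * |C| * (alpha D * ell D ^ 2) ≤ 3 * |C| * π := by gcongr
        nlinarith [Real.pi_lt_d2, abs_nonneg C]
      calc (4 + 3 * |C| * (alpha D * ell D ^ 2)) * (e3 * frakA χ * frakP D)
          ≤ (4 + 10 * |C|) * (e3 * frakA χ * frakP D) := by gcongr
        _ = (4 + 10 * |C|) * e3 * frakA χ * frakP D := by ring
    linarith
  have hms := meanSq_le_two_norm_Theta1_add c' χ bD hre hcIm hωIm k81
  calc ∑ i ∈ idx χ, (cstar c' D i.1 i.2).re * ‖Apoly i.1 bD i.2‖ ^ 2 * (omegaW D i.2).re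
      ≤ 2 * ‖Theta1 c' χ bD bb‖ + ε * a₀ / 8 * frakP D := hms
    _ ≤ 2 * ((4 + 10 * |C|) * e3 * frakA χ * frakP D + ε * a₀ / 8 * frakP D) +
          ε * a₀ / 8 * frakP D := by linarith
    _ = (2 * (4 + 10 * |C|) * e3) * (frakA χ * frakP D) + (3 * ε / 8) * (a₀ * frakP D) := by ring
    _ ≤ (ε / 4) * (frakA χ * frakP D) + (3 * ε / 8) * (frakA χ * frakP D) := by
        have h1 : 2 * (4 + 10 * |C|) * e3 ≤ ε / 4 := by
          rw [he3, show 2 * (4 + 10 * |C|) * (ε / (8 * (4 + 10 * |C| + 1))) =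
            (ε / 4) * ((4 + 10 * |C|) / (4 + 10 * |C| + 1)) by field_simp; ring]
          have : (4 + 10 * |C|) / (4 + 10 * |C| + 1) ≤ 1 := by
            rw [div_le_one (by positivity)]; linarith
          nlinarith
        have h2 : a₀ * frakP D ≤ frakA χ * frakP D := mul_le_mul_of_nonneg_right ha hP
        nlinarith [mul_nonneg hfa hP]
    _ ≤ ε * frakA χ * frakP D := by nlinarith [mul_nonneg hfa hP]

/-- **The fine reduction, closed form**: for every sufficiently large `c′`, given only the
admissibility of `𝐛` and the `S_j`-estimate `hS` (Lemma 2.3 / Lemma 8.1: `Skeleton.partOne_eventually`;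
Prop. 2.2 (i): `Skeleton.prop22i_holds`; Prop. 7.1: `Section7cStatements.prop71X_holds`).
[cite: Zhang2022LandauSiegel, §7 Prop. 7.1; §8 Lemma 8.1] -/
theorem meanSq_le_of_sj_small_eventually :
    ∃ c₀ : ℝ, 0 ≤ c₀ ∧ ∀ c' : ℝ, c₀ ≤ c' → ∀ {B : ℝ} (b : (D : ℕ) → DirichletCharacter ℂ D → ℕ → ℂ),
      (ForAllLarge fun D _ χ => Adm72 D B (b D χ)) →
      (∀ ε : ℝ, 0 < ε → ForAllLarge fun D _ χ => AssumptionA D χ →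
        ∀ j ∈ ({1, 2, 3} : Finset ℕ),
          ‖Sj c' D j (b D χ) (fun n => conj (b D χ n))‖ ≤ ε * alpha D * frakA χ) →
      ∀ ε : ℝ, 0 < ε → ForAllLarge fun D _ χ => AssumptionA D χ →
        ∑ i ∈ idx χ, (cstar c' D i.1 i.2).re * ‖Apoly i.1 (b D χ) i.2‖ ^ 2 * (omegaW D i.2).re ≤
          ε * frakA χ * frakP D := by
  obtain ⟨c₀, h0, h⟩ := partOne_eventually
  exact ⟨c₀, h0, fun c' hc' B b hadm hS =>
    meanSq_le_of_sj_small c' prop22i_holds (h c' hc').2.1 (h c' hc').2.2.1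
      (Section7cStatements.prop71X_holds c') b hadm hS⟩

end Fine

end Literature.NumberTheory.LFunctions.Zhang2022.DiscreteMeanSquare
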